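import Literature.RingTheory.Nullstellensatz.PerronTheorem
import Literature.RingTheory.NoetherNormalization.LinearFamily
import Mathlib.RingTheory.Nullstellensatz
import Mathlib.RingTheory.AlgebraicIndependent.TranscendenceBasis
import Mathlib.FieldTheory.Minpoly.IsIntegrallyClosed
import Mathlib.RingTheory.Polynomial.RationalRoot
import Mathlib.RingTheory.Polynomial.UniqueFactorization
import Mathlib.Algebra.MvPolynomial.NoZeroDivisors
import HarnessLib

/-!
# An effective Nullstellensatz with a single-exponential degree bound (after Jelonek)

Topic `Literature/RingTheory/Nullstellensatz`. Z. Jelonek, *On the effective Nullstellensatz*,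
Invent. Math. 162 (2005), Thm. 1.1: if `f_1, …, f_s ∈ K[x_1, …, x_n]` (`K` algebraically closed)
have no common zero and `deg f_i = d_i`, `d_1 ≥ ⋯ ≥ d_s`, then `1 = ∑ g_i f_i` with
`deg g_i f_i ≤ d_1 ⋯ d_{min(s,n)}` type bounds (sharp; the earlier single-exponential bounds are
Brownawell 1987 and Kollár 1988). Jelonek's proof is elementary: in `K[x, z]` the polynomials
`u_i = z f_i` and `x_j` generate the whole ring (as `1 = ∑ a_i f_i` by the classical
Nullstellensatz), a generic linear projection `L_1, …, L_{n+1}` of these generators makes `K[x, z]`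
integral over `K[L]` (Noether normalisation), Perron's theorem bounds the degree of an algebraic
relation of `(L, z)`, hence of the minimal polynomial of `z` over the polynomial ring `K[L]`,
and comparing coefficients of the top power of `z` in that minimal polynomial, after substituting
`L_j = λ_j(x) + ψ_j(x) z` (`ψ_j ∈ span f`), yields `1 = ∑ g_i f_i` with controlled degrees
(see also Jelonek, *Elimination ideals and Bezout relations* (2019), §2, for the same device).

This file carries the argument out with the WEAK Perron theorem of `PerronTheorem.lean`
(dimension count), which wastes all constants but keeps the bound single-exponential in `n`:
**`deg g_i ≤ effNSBound n d = (d+1) (n+2) (2(d+1)(n+2))^{n+1}`** for `deg f_i ≤ d`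
(`exists_sum_mul_eq_one_of_forall_exists_ne_zero`). Coefficients may lie in any infinite subfield
`k ⊆ K` (the zeros being taken in `K`), as in Mathlib's `MvPolynomial.vanishingIdeal_zeroLocus_eq_radical`.

## Contents (namespace `Literature.RingTheory.Nullstellensatz`, everything proved)

* `combo`, `idealUpTo`, `mem_idealUpTo_iff`, `idealUpTo_mono`, `mul_mem_idealUpTo`,
  `span_le_idealUpTo_zero` — the degree-`D` pieces `(f)_{≤ D} = {∑ g_i f_i : deg g_i ≤ D}`;
* `GoodCoeffs`, `linSubst`, `goodCoeffs_aeval_linSubst` — the extraction device: for `H` of degree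
  `≤ B`, the positive-order coefficients in `Z` of `H(λ + ψ Z)` lie in `(f)_{≤ B(d+1)}`;
* `finSuccEquiv_rename_succ`, `exists_relation_of_card_eq_succ` — auxiliary;
* `effNSBound`, `exists_sum_mul_eq_one_of_forall_exists_ne_zero` — **the effective
  Nullstellensatz**.

## References

* Z. Jelonek, *On the effective Nullstellensatz*, Invent. Math. 162 (2005), 1–17, Thm. 1.1 and
  its proof. [Jelonek2005]
* A. Płoski, *Algebraic dependence of polynomials after O. Perron and some applications* (2005)
  (Perron's theorem). [Ploski2005]
* G.-M. Greuel, G. Pfister, *A Singular Introduction to Commutative Algebra* (2002), Thm. 3.4.1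
  (Noether normalisation by linear change, infinite field). [GreuelPfister2002]
-/

noncomputable section

open MvPolynomial

namespace Literature.RingTheory.Nullstellensatz

/-! ### Degree-bounded pieces of an ideal -/

section IdealUpTo

variable {k : Type*} [Field k] {σ : Type*} {ι : Type*} [Fintype ι]

/-- `g ↦ ∑ i, g_i f_i`, a `k`-linear map `(ι → k[X]) → k[X]`. [folklore] -/
def combo (f : ι → MvPolynomial σ k) : (ι → MvPolynomial σ k) →ₗ[k] MvPolynomial σ k :=
  ∑ i, (LinearMap.mulRight k (f i)).comp (LinearMap.proj i)

/-- `combo f g = ∑ g_i f_i`. [folklore] -/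
theorem combo_apply (f : ι → MvPolynomial σ k) (g : ι → MvPolynomial σ k) :
    combo f g = ∑ i, g i * f i := by
  simp [combo]

/-- The degree-`D` piece of the ideal `(f_i)`: all `∑ g_i f_i` with `deg g_i ≤ D`
(a `k`-subspace). [folklore] -/
def idealUpTo (f : ι → MvPolynomial σ k) (D : ℕ) : Submodule k (MvPolynomial σ k) :=
  (Submodule.pi Set.univ fun _ : ι => restrictTotalDegree σ k D).map (combo f)

/-- Membership in `(f)_{≤ D}`. [folklore] -/
theorem mem_idealUpTo_iff {f : ι → MvPolynomial σ k} {D : ℕ} {x : MvPolynomial σ k} :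
    x ∈ idealUpTo f D ↔
      ∃ g : ι → MvPolynomial σ k, (∀ i, (g i).totalDegree ≤ D) ∧ ∑ i, g i * f i = x := by
  constructor
  · rintro ⟨g, hg, rfl⟩
    refine ⟨g, fun i => ?_, (combo_apply f g).symm⟩
    exact (mem_restrictTotalDegree _ _ _).1 (hg i (Set.mem_univ i))
  · rintro ⟨g, hg, rfl⟩
    refine ⟨g, fun i _ => (mem_restrictTotalDegree _ _ _).2 (hg i), combo_apply f g⟩

/-- `(f)_{≤ D}` grows with `D`. [folklore] -/
theorem idealUpTo_mono (f : ι → MvPolynomial σ k) {D D' : ℕ} (h : D ≤ D') :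
    idealUpTo f D ≤ idealUpTo f D' := by
  intro x hx
  obtain ⟨g, hg, rfl⟩ := mem_idealUpTo_iff.1 hx
  exact mem_idealUpTo_iff.2 ⟨g, fun i => (hg i).trans h, rfl⟩

/-- `k[X]_{≤ D'} · (f)_{≤ D} ⊆ (f)_{≤ D' + D}`. [folklore] -/
theorem mul_mem_idealUpTo (f : ι → MvPolynomial σ k) {D D' : ℕ} {h x : MvPolynomial σ k}
    (hh : h.totalDegree ≤ D') (hx : x ∈ idealUpTo f D) : h * x ∈ idealUpTo f (D' + D) := by
  obtain ⟨g, hg, rfl⟩ := mem_idealUpTo_iff.1 hx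
  refine mem_idealUpTo_iff.2 ⟨fun i => h * g i, fun i => ?_, ?_⟩
  · exact (totalDegree_mul _ _).trans (add_le_add hh (hg i))
  · simp only [Finset.mul_sum, mul_assoc]

/-- The `k`-span of the `f_i` lies in `(f)_{≤ 0}`. [folklore] -/
theorem span_le_idealUpTo_zero (f : ι → MvPolynomial σ k) :
    Submodule.span k (Set.range f) ≤ idealUpTo f 0 := by
  classical
  rw [Submodule.span_le]
  rintro _ ⟨i, rfl⟩
  refine mem_idealUpTo_iff.2 ⟨fun j => if j = i then 1 else 0, fun j => ?_, ?_⟩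
  · by_cases hj : j = i <;> simp [hj]
  · simp [Finset.sum_ite_eq', ite_mul]

end IdealUpTo

/-! ### Coefficients of `H(λ + ψ Z)` modulo the ideal, with degree bounds -/

section GoodCoeffs

variable {k : Type*} [Field k] {σ : Type*} {ι : Type*} [Fintype ι]

/-- The extraction predicate: every positive-order coefficient (in `Z`) of `G ∈ k[X][Z]` lies in
`(f)_{≤ D(d+1)}`, and the constant coefficient has degree `≤ D`. [folklore] -/
def GoodCoeffs (f : ι → MvPolynomial σ k) (d : ℕ) (G : Polynomial (MvPolynomial σ k)) (D : ℕ) :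
    Prop :=
  (∀ e, 1 ≤ e → G.coeff e ∈ idealUpTo f (D * (d + 1))) ∧ (G.coeff 0).totalDegree ≤ D

variable {f : ι → MvPolynomial σ k} {d : ℕ}

/-- The predicate is monotone in the level. [folklore] -/
theorem GoodCoeffs.mono {G : Polynomial (MvPolynomial σ k)} {D D' : ℕ} (hG : GoodCoeffs f d G D)
    (h : D ≤ D') : GoodCoeffs f d G D' :=
  ⟨fun e he => idealUpTo_mono f (Nat.mul_le_mul_right _ h) (hG.1 e he), hG.2.trans h⟩

/-- The predicate is additive. [folklore] -/
theorem GoodCoeffs.add {G₁ G₂ : Polynomial (MvPolynomial σ k)} {D : ℕ} (h₁ : GoodCoeffs f d G₁ D)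
    (h₂ : GoodCoeffs f d G₂ D) : GoodCoeffs f d (G₁ + G₂) D := by
  refine ⟨fun e he => ?_, ?_⟩
  · rw [Polynomial.coeff_add]; exact add_mem (h₁.1 e he) (h₂.1 e he)
  · rw [Polynomial.coeff_add]
    exact (totalDegree_add _ _).trans (max_le h₁.2 h₂.2)

/-- `0` is good. [folklore] -/
theorem GoodCoeffs.zero (D : ℕ) : GoodCoeffs f d 0 D :=
  ⟨fun e _ => by rw [Polynomial.coeff_zero]; exact zero_mem _, by simp⟩

/-- Finite sums of good polynomials are good. [folklore] -/
theorem GoodCoeffs.sum {α : Type*} (s : Finset α) {G : α → Polynomial (MvPolynomial σ k)} {D : ℕ}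
    (h : ∀ a ∈ s, GoodCoeffs f d (G a) D) : GoodCoeffs f d (∑ a ∈ s, G a) D := by
  classical
  induction s using Finset.induction_on with
  | empty => simpa using GoodCoeffs.zero D
  | insert a s ha ih =>
    rw [Finset.sum_insert ha]
    exact (h a (Finset.mem_insert_self a s)).add (ih fun b hb => h b (Finset.mem_insert_of_mem hb))

/-- Constants `C a`, `deg a ≤ D`, are good at level `D`. [folklore] -/
theorem GoodCoeffs.C {a : MvPolynomial σ k} {D : ℕ} (ha : a.totalDegree ≤ D) :
    GoodCoeffs f d (Polynomial.C a) D :=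
  ⟨fun e he => by
    rw [Polynomial.coeff_C, if_neg (by omega)]; exact zero_mem _,
   by rwa [Polynomial.coeff_C_zero]⟩

/-- **The linear-factor step**: multiplying by `λ + ψ Z` with `deg λ ≤ 1`, `ψ ∈ span_k(f)`,
`deg ψ ≤ d` raises the level by one. [folklore] -/
theorem GoodCoeffs.linear_mul {lam ψ : MvPolynomial σ k} (hlam : lam.totalDegree ≤ 1)
    (hψ : ψ ∈ Submodule.span k (Set.range f)) (hψd : ψ.totalDegree ≤ d)
    {G : Polynomial (MvPolynomial σ k)} {D : ℕ} (hG : GoodCoeffs f d G D) :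
    GoodCoeffs f d ((Polynomial.C lam + Polynomial.X * Polynomial.C ψ) * G) (D + 1) := by
  have hexp : (Polynomial.C lam + Polynomial.X * Polynomial.C ψ) * G =
      Polynomial.C lam * G + Polynomial.X * (Polynomial.C ψ * G) := by ring
  rw [hexp]
  have hle1 : 1 + D * (d + 1) ≤ (D + 1) * (d + 1) := by nlinarith
  have hle2 : d + D * (d + 1) ≤ (D + 1) * (d + 1) := by nlinarith
  have hle3 : D + 0 ≤ (D + 1) * (d + 1) := by nlinarith
  refine ⟨fun e he => ?_, ?_⟩
  · rw [Polynomial.coeff_add, Polynomial.coeff_C_mul]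
    refine add_mem (idealUpTo_mono f hle1 (mul_mem_idealUpTo f hlam (hG.1 e he))) ?_
    obtain ⟨e', rfl⟩ : ∃ e', e = e' + 1 := ⟨e - 1, by omega⟩
    rw [Polynomial.coeff_X_mul, Polynomial.coeff_C_mul]
    rcases Nat.eq_zero_or_pos e' with h0 | hpos
    · subst h0
      rw [mul_comm ψ]
      exact idealUpTo_mono f hle3 (mul_mem_idealUpTo f hG.2 (span_le_idealUpTo_zero f hψ))
    · exact idealUpTo_mono f hle2 (mul_mem_idealUpTo f hψd (hG.1 e' hpos))
  · rw [Polynomial.coeff_add, Polynomial.coeff_C_mul, Polynomial.coeff_X_mul_zero, add_zero]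
    exact (totalDegree_mul _ _).trans (add_comm D 1 ▸ add_le_add hlam hG.2)

variable {τ : Type*} (lam ψ : τ → MvPolynomial σ k)

/-- The linear substitution `T_t ↦ λ_t + ψ_t Z`. [folklore] -/
def linSubst (t : τ) : Polynomial (MvPolynomial σ k) :=
  Polynomial.C (lam t) + Polynomial.X * Polynomial.C (ψ t)

variable {lam ψ}
variable (hlam : ∀ t, (lam t).totalDegree ≤ 1) (hψ : ∀ t, ψ t ∈ Submodule.span k (Set.range f))
  (hψd : ∀ t, (ψ t).totalDegree ≤ d)
include hlam hψ hψd

/-- Multiplying by a power `(λ_t + ψ_t Z)^j` raises the level by `j`. [folklore] -/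
theorem GoodCoeffs.pow_mul (t : τ) {G : Polynomial (MvPolynomial σ k)} {D : ℕ}
    (hG : GoodCoeffs f d G D) : ∀ j : ℕ, GoodCoeffs f d (linSubst lam ψ t ^ j * G) (D + j)
  | 0 => by simpa using hG
  | j + 1 => by
    rw [pow_succ', mul_assoc, ← add_assoc]
    exact (GoodCoeffs.pow_mul t hG j).linear_mul (hlam t) (hψ t) (hψd t)

/-- Multiplying by a monomial `∏ (λ_t + ψ_t Z)^{m_t}` raises the level by `|m|`. [folklore] -/
theorem GoodCoeffs.prod_mul [DecidableEq τ] (s : Finset τ) (m : τ → ℕ)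
    {G : Polynomial (MvPolynomial σ k)} {D : ℕ} (hG : GoodCoeffs f d G D) :
    GoodCoeffs f d ((∏ t ∈ s, linSubst lam ψ t ^ m t) * G) (D + ∑ t ∈ s, m t) := by
  induction s using Finset.induction_on with
  | empty => simpa using hG
  | insert a s ha ih =>
    rw [Finset.prod_insert ha, Finset.sum_insert ha, mul_assoc, add_comm (m a), ← add_assoc]
    exact GoodCoeffs.pow_mul hlam hψ hψd a ih (m a)

/-- **Coefficients of `H(λ + ψZ)`**: for `H` of degree `≤ B`, every positive-order coefficient of
`H(λ_1 + ψ_1 Z, …)` in `Z` lies in `(f)_{≤ B(d+1)}` and the constant one has degree `≤ B`.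
[folklore] -/
theorem goodCoeffs_aeval_linSubst {H : MvPolynomial τ k} {B : ℕ} (hH : H.totalDegree ≤ B) :
    GoodCoeffs f d (aeval (linSubst lam ψ) H) B := by
  classical
  conv => arg 3; rw [H.as_sum, map_sum]
  refine GoodCoeffs.sum _ fun m hm => ?_
  rw [aeval_monomial, Finsupp.prod, mul_comm]
  have hC : GoodCoeffs f d (algebraMap k (Polynomial (MvPolynomial σ k)) (coeff m H)) 0 := by
    rw [Polynomial.algebraMap_apply, MvPolynomial.algebraMap_eq]
    exact GoodCoeffs.C (by simp)
  have h := GoodCoeffs.prod_mul hlam hψ hψd m.support m hC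
  rw [zero_add] at h
  refine h.mono ?_
  calc ∑ t ∈ m.support, m t = m.sum fun _ e => e := rfl
    _ ≤ H.totalDegree := le_totalDegree hm
    _ ≤ B := hH

end GoodCoeffs

/-! ### Auxiliary facts about `k[X_0, …, X_n]` -/

section Aux

variable {k : Type*} [Field k] {n : ℕ}

/-- `finSuccEquiv` sends a polynomial in `X_1, …, X_n` to the corresponding constant of
`k[X_1, …, X_n][X_0]`. [folklore] -/
theorem finSuccEquiv_rename_succ (p : MvPolynomial (Fin n) k) :
    finSuccEquiv k n (rename Fin.succ p) = Polynomial.C p := by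
  have h : ((finSuccEquiv k n).toAlgHom.comp (rename Fin.succ)) =
      (Polynomial.CAlgHom : MvPolynomial (Fin n) k →ₐ[k] Polynomial (MvPolynomial (Fin n) k)) := by
    refine MvPolynomial.algHom_ext fun j => ?_
    simp [finSuccEquiv_X_succ]
  exact congrArg (fun g : MvPolynomial (Fin n) k →ₐ[k] _ => g p) h

/-- Any `n + 2` polynomials in `n + 1` variables are algebraically dependent (transcendence
degree). [folklore] -/
theorem exists_relation_of_card_eq_succ (w : Fin (n + 2) → MvPolynomial (Fin (n + 1)) k) :
    ∃ F : MvPolynomial (Fin (n + 2)) k, F ≠ 0 ∧ aeval w F = 0 := by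
  by_contra h
  have hw : AlgebraicIndependent k w :=
    algebraicIndependent_iff.2 fun F hF => by_contra fun hne => h ⟨F, hne, hF⟩
  have h1 := hw.lift_cardinalMk_le_trdeg
  rw [MvPolynomial.trdeg_of_isDomain, Cardinal.mk_fin, Cardinal.mk_fin] at h1
  simp only [Cardinal.lift_natCast] at h1
  norm_cast at h1
  omega

end Aux

/-! ### The effective Nullstellensatz -/

section Main

variable {k : Type*} [Field k] [Infinite k] {K : Type*} [Field K] [Algebra k K] [IsAlgClosed K]

/-- The degree bound of the effective Nullstellensatz proved here:
`(d + 1) · (n + 2) · (2 (d + 1) (n + 2))^{n+1}`. [folklore] -/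
def effNSBound (n d : ℕ) : ℕ := perronBound (n + 1) (d + 1) * (d + 1)

/-- **Effective Nullstellensatz with a single-exponential degree bound** (after Z. Jelonek, *On the
effective Nullstellensatz*, Invent. Math. 162 (2005), Thm. 1.1, whose sharp bound for
`deg g_i f_i` is `d_1 ⋯ d_n`-type; here with the crude constant `effNSBound n d` coming from the
weak Perron theorem). Let `k` be an infinite field, `K ⊇ k` algebraically closed, and
`f_1, …, f_s ∈ k[X_1, …, X_n]` of degree `≤ d` without common zero in `Kⁿ`. Then
`1 = ∑ g_i f_i` with `deg g_i ≤ effNSBound n d`.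

Proof (Jelonek's method): by the Nullstellensatz `1 = ∑ a_i f_i` for some `a_i`; in
`R = k[X, Z]` put `u_i = Z f_i`, so `R = k[u, X]`; by linear Noether normalisation
(`exists_linear_noether_normalization`) `R` is integral over `k[L_0, …, L_n]` for `n + 1` linear
combinations `L_j = λ_j(X) + ψ_j(X) Z` of the `u_i, X_j` (`ψ_j ∈ span_k f`), which are then
algebraically independent; the weak Perron theorem gives `P ≠ 0`, `P(Z, L) = 0`, of degree `≤ B`;
the minimal polynomial `μ` of `Z` over the polynomial ring `k[L]` divides `P` (integrally closed),
so its coefficients have degree `≤ B`; finally in `μ(Z) = Z^M + ∑_{j<M} μ_j(λ + ψZ) Z^j = 0` the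
coefficient of `Z^M` reads `1 + ∑ g_i f_i = 0` with `deg g_i ≤ B (d + 1)`
(`goodCoeffs_aeval_linSubst`). [cite: Jelonek2005, Thm. 1.1 (weak form)] -/
theorem exists_sum_mul_eq_one_of_forall_exists_ne_zero {n s d : ℕ}
    (f : Fin s → MvPolynomial (Fin n) k) (hd : ∀ i, (f i).totalDegree ≤ d)
    (hV : ∀ x : Fin n → K, ∃ i, aeval x (f i) ≠ 0) :
    ∃ g : Fin s → MvPolynomial (Fin n) k, ∑ i, g i * f i = 1 ∧
      ∀ i, (g i).totalDegree ≤ effNSBound n d := by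
  classical
  -- Step 0: the classical Nullstellensatz
  obtain ⟨a, ha⟩ : ∃ a : Fin s → MvPolynomial (Fin n) k, ∑ i, a i * f i = 1 := by
    set I : Ideal (MvPolynomial (Fin n) k) := Ideal.span (Set.range f) with hI
    have hZ : MvPolynomial.zeroLocus K I = ∅ := by
      refine Set.eq_empty_iff_forall_notMem.2 fun x hx => ?_
      obtain ⟨i, hi⟩ := hV x
      exact hi ((MvPolynomial.mem_zeroLocus_iff.1 hx) (f i) (Ideal.subset_span ⟨i, rfl⟩))
    have hrad := MvPolynomial.vanishingIdeal_zeroLocus_eq_radical (K := K) I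
    rw [hZ, MvPolynomial.vanishingIdeal_empty, eq_comm, Ideal.radical_eq_top] at hrad
    have h1 : (1 : MvPolynomial (Fin n) k) ∈ I := hrad ▸ Submodule.mem_top
    exact Ideal.mem_span_range_iff_exists_fun.1 h1
  -- `s ≥ 1`
  have hs : 1 ≤ s := by
    rcases Nat.eq_zero_or_pos s with h0 | h0
    · subst h0; obtain ⟨i, -⟩ := hV 0; exact i.elim0
    · exact h0
  -- Step 1: the ring `R = k[X_0, X_1, …, X_n]` (`X_0` playing `Z`) and the generators
  set z : MvPolynomial (Fin (n + 1)) k := X 0 with hz0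
  set u : Fin s → MvPolynomial (Fin (n + 1)) k := fun i => z * rename Fin.succ (f i) with hu
  set v : Fin n → MvPolynomial (Fin (n + 1)) k := fun j => X j.succ with hv
  set y : Fin (s + n) → MvPolynomial (Fin (n + 1)) k := Fin.append u v with hy
  have hyu : ∀ i, u i ∈ Set.range y := fun i => ⟨Fin.castAdd n i, by rw [hy, Fin.append_left]⟩
  have hyv : ∀ j, v j ∈ Set.range y := fun j => ⟨Fin.natAdd s j, by rw [hy, Fin.append_right]⟩
  -- `k[y] = R`
  have hX0 : z ∈ Algebra.adjoin k (Set.range y) := by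
    have h1 : z = ∑ i, rename Fin.succ (a i) * u i := by
      have := congrArg (rename (Fin.succ : Fin n → Fin (n + 1))) ha
      rw [map_sum, map_one] at this
      calc z = z * 1 := (mul_one z).symm
        _ = z * ∑ i, rename Fin.succ (a i * f i) := by rw [this]
        _ = ∑ i, rename Fin.succ (a i) * u i := by
            rw [Finset.mul_sum]
            exact Finset.sum_congr rfl fun i _ => by simp only [map_mul, hu]; ring
    rw [h1]
    refine Subalgebra.sum_mem _ fun i _ => Subalgebra.mul_mem _ ?_ (Algebra.subset_adjoin (hyu i))
    have hsub : Set.range (fun j : Fin n => (X j.succ : MvPolynomial (Fin (n + 1)) k)) ⊆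
        Set.range y := by
      rintro _ ⟨j, rfl⟩; exact hyv j
    refine Algebra.adjoin_mono hsub ?_
    have hren : (rename Fin.succ : MvPolynomial (Fin n) k →ₐ[k] MvPolynomial (Fin (n + 1)) k) =
        aeval (fun j : Fin n => (X j.succ : MvPolynomial (Fin (n + 1)) k)) :=
      MvPolynomial.algHom_ext fun j => by simp
    rw [hren, Algebra.adjoin_range_eq_range_aeval]
    exact AlgHom.mem_range_self _ _
  have htop : Algebra.adjoin k (Set.range y) = ⊤ := by
    rw [eq_top_iff, ← MvPolynomial.adjoin_range_X, Algebra.adjoin_le_iff]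
    rintro _ ⟨m, rfl⟩
    refine Fin.cases hX0 (fun j => Algebra.subset_adjoin (hyv j)) m
  have hint : ∀ b : MvPolynomial (Fin (n + 1)) k, IsIntegral (Algebra.adjoin k (Set.range y)) b :=
    fun b => Literature.RingTheory.NoetherNormalization.isIntegral_of_mem_subalgebra
      (by rw [htop]; exact Algebra.mem_top)
  -- degrees: every element of `span_k y` has degree `≤ d + 1`
  have hudeg : ∀ i, (u i).totalDegree ≤ d + 1 := fun i => by
    rw [hu]
    refine (totalDegree_mul _ _).trans ?_
    rw [add_comm]
    exact add_le_add ((totalDegree_rename_le _ _).trans (hd i)) (by rw [hz0, totalDegree_X])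
  have hvdeg : ∀ j, (v j).totalDegree ≤ d + 1 := fun j => by
    rw [hv]
    change (X j.succ : MvPolynomial (Fin (n + 1)) k).totalDegree ≤ d + 1
    rw [totalDegree_X]; omega
  have hydeg : ∀ m, (y m).totalDegree ≤ d + 1 := by
    intro m
    refine Fin.addCases (fun i => ?_) (fun j => ?_) m
    · rw [hy, Fin.append_left]; exact hudeg i
    · rw [hy, Fin.append_right]; exact hvdeg j
  have hspan_deg : ∀ w ∈ Submodule.span k (Set.range y),
      (w : MvPolynomial (Fin (n + 1)) k).totalDegree ≤ d + 1 := by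
    intro w hw
    have hle : Submodule.span k (Set.range y) ≤ restrictTotalDegree (Fin (n + 1)) k (d + 1) :=
      Submodule.span_le.2 (by rintro _ ⟨m, rfl⟩; exact (mem_restrictTotalDegree _ _ _).2 (hydeg m))
    exact (mem_restrictTotalDegree _ _ _).1 (hle hw)
  -- Step 2: linear Noether normalisation, `n + 1` independent linear combinations `L`
  obtain ⟨L, hLspan, hLint⟩ :=
    Literature.RingTheory.NoetherNormalization.exists_linear_noether_normalization (k := k)
      (A := MvPolynomial (Fin (n + 1)) k) (n + 1) (s + n) y (by omega) hint
      (fun w _ => exists_relation_of_card_eq_succ w)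
  set S : Subalgebra k (MvPolynomial (Fin (n + 1)) k) := Algebra.adjoin k (Set.range L) with hS
  haveI hIntS : Algebra.IsIntegral S (MvPolynomial (Fin (n + 1)) k) := ⟨hLint⟩
  have hTB : IsTranscendenceBasis k L :=
    Algebra.IsAlgebraic.isTranscendenceBasis_of_lift_le_trdeg_of_finite k L (by
      simp only [MvPolynomial.trdeg_of_isDomain, Cardinal.mk_fin, Cardinal.lift_natCast, le_refl])
  have hL : AlgebraicIndependent k L := hTB.1
  -- Step 3: weak Perron for `(Z, L_0, …, L_n)`
  set Q : Fin (n + 2) → MvPolynomial (Fin (n + 1)) k := Fin.cons z L with hQ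
  have hQdeg : ∀ i, (Q i).totalDegree ≤ d + 1 := by
    intro i
    refine Fin.cases ?_ (fun t => ?_) i
    · change z.totalDegree ≤ d + 1
      rw [hz0, totalDegree_X]; omega
    · change (L t).totalDegree ≤ d + 1
      exact hspan_deg _ (hLspan t)
  obtain ⟨P, hP0, hPQ, -, hPdeg⟩ :=
    exists_algRelation_of_totalDegree_le (N := n + 1) Q (δ := d + 1) (by omega) hQdeg
  set B := perronBound (n + 1) (d + 1) with hB
  -- Step 4: the minimal polynomial of `Z` over `k[L] ≅ k[T_0, …, T_n]`
  set φ : MvPolynomial (Fin (n + 1)) k ≃ₐ[k] S := hL.aevalEquiv with hφ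
  haveI : UniqueFactorizationMonoid S :=
    (φ.toMulEquiv).uniqueFactorizationMonoid inferInstance
  have hzint : IsIntegral S z := hLint z
  set μ := minpoly S z with hμ
  -- `P`, as a polynomial in its first variable with coefficients transported to `S`
  set P' : Polynomial S :=
    (finSuccEquiv k (n + 1) P).map (φ : MvPolynomial (Fin (n + 1)) k →+* S) with hP'
  have hcompφ : (algebraMap S (MvPolynomial (Fin (n + 1)) k)).comp
      (φ : MvPolynomial (Fin (n + 1)) k →+* S) =
      (aeval L : MvPolynomial (Fin (n + 1)) k →ₐ[k] MvPolynomial (Fin (n + 1)) k).toRingHom :=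
    RingHom.ext fun p => hL.algebraMap_aevalEquiv p
  have hP'z : Polynomial.aeval z P' = 0 := by
    rw [Polynomial.aeval_def, hP', Polynomial.eval₂_map, hcompφ]
    change Polynomial.aevalTower
      (aeval L : MvPolynomial (Fin (n + 1)) k →ₐ[k] MvPolynomial (Fin (n + 1)) k) z
      (finSuccEquiv k (n + 1) P) = 0
    rw [← Literature.RingTheory.NoetherNormalization.aeval_finCons_eq_aevalTower_finSuccEquiv]
    exact hPQ
  have hdvd : μ ∣ P' := minpoly.isIntegrallyClosed_dvd hzint hP'z
  -- back in `k[T_0, …, T_{n+1}]`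
  set μ₀ : Polynomial (MvPolynomial (Fin (n + 1)) k) :=
    μ.map (φ.symm : S →+* MvPolynomial (Fin (n + 1)) k) with hμ₀
  have hsymmφ : (φ.symm : S →+* MvPolynomial (Fin (n + 1)) k).comp
      (φ : MvPolynomial (Fin (n + 1)) k →+* S) = RingHom.id _ :=
    RingHom.ext fun p => φ.symm_apply_apply p
  have hφsymm : (φ : MvPolynomial (Fin (n + 1)) k →+* S).comp
      (φ.symm : S →+* MvPolynomial (Fin (n + 1)) k) = RingHom.id _ :=
    RingHom.ext fun p => φ.apply_symm_apply p
  have hμ₀μ : μ₀.map (φ : MvPolynomial (Fin (n + 1)) k →+* S) = μ := by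
    rw [hμ₀, Polynomial.map_map, hφsymm, Polynomial.map_id]
  have hdvd₀ : μ₀ ∣ finSuccEquiv k (n + 1) P := by
    have h := Polynomial.map_dvd (φ.symm : S →+* MvPolynomial (Fin (n + 1)) k) hdvd
    rwa [hP', Polynomial.map_map, hsymmφ, Polynomial.map_id] at h
  set G : MvPolynomial (Fin (n + 2)) k := (finSuccEquiv k (n + 1)).symm μ₀ with hG
  have hGμ₀ : finSuccEquiv k (n + 1) G = μ₀ := (finSuccEquiv k (n + 1)).apply_symm_apply μ₀
  have hGdvd : G ∣ P := by
    obtain ⟨q, hq⟩ := hdvd₀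
    refine ⟨(finSuccEquiv k (n + 1)).symm q, ?_⟩
    apply (finSuccEquiv k (n + 1)).injective
    rw [map_mul, hGμ₀, (finSuccEquiv k (n + 1)).apply_symm_apply, hq]
  have hGdeg : G.totalDegree ≤ B := (totalDegree_le_of_dvd_of_isDomain hGdvd hP0).trans hPdeg
  have hcoeff_deg : ∀ j, (μ₀.coeff j).totalDegree ≤ B := by
    intro j
    by_cases h0 : μ₀.coeff j = 0
    · rw [h0, totalDegree_zero]; exact Nat.zero_le _
    · rw [← hGμ₀] at h0 ⊢
      exact le_trans (Nat.le_add_right _ _)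
        ((totalDegree_coeff_finSuccEquiv_add_le G j h0).trans hGdeg)
  -- `μ₀` is monic of positive degree `M`
  have hμm : μ.Monic := minpoly.monic hzint
  have hμ₀m : μ₀.Monic := hμm.map _
  set M := μ₀.natDegree with hM
  have hM1 : 1 ≤ M := by
    rw [hM, hμ₀, (minpoly.monic hzint).natDegree_map]
    exact minpoly.natDegree_pos hzint
  -- the identity `∑_j (aeval L (μ₀ⱼ)) z^j = 0` in `R`
  have hident : ∑ j ∈ Finset.range (M + 1), aeval L (μ₀.coeff j) * z ^ j = 0 := by
    have h := minpoly.aeval S z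
    rw [← hμ, ← hμ₀μ, Polynomial.aeval_def, Polynomial.eval₂_map, hcompφ,
      Polynomial.eval₂_eq_sum_range] at h
    exact h
  -- Step 5: pass to `A[Z]`, `A = k[X_1, …, X_n]`, through `Φ = finSuccEquiv k n`
  have hΦu : ∀ (i : Fin s) (c : k), finSuccEquiv k n (c • u i) =
      Polynomial.X * Polynomial.C (c • f i) := by
    intro i c
    rw [map_smul, hu]
    change c • finSuccEquiv k n (z * rename Fin.succ (f i)) = _
    rw [map_mul, hz0, finSuccEquiv_X_zero, finSuccEquiv_rename_succ, ← Polynomial.smul_C,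
      mul_smul_comm]
  have hΦv : ∀ (j : Fin n) (c : k), finSuccEquiv k n (c • v j) = Polynomial.C (c • X j) := by
    intro j c
    rw [map_smul, hv]
    change c • finSuccEquiv k n (X j.succ) = _
    rw [finSuccEquiv_X_succ, Polynomial.smul_C]
  -- the linear decomposition of the `L_t`
  have hdecomp : ∀ t, ∃ lam ψ : MvPolynomial (Fin n) k, lam.totalDegree ≤ 1 ∧
      ψ ∈ Submodule.span k (Set.range f) ∧ ψ.totalDegree ≤ d ∧
      finSuccEquiv k n (L t) = Polynomial.C lam + Polynomial.X * Polynomial.C ψ := by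
    intro t
    obtain ⟨c, hc⟩ := (Submodule.mem_span_range_iff_exists_fun k).1 (hLspan t)
    refine ⟨∑ j, c (Fin.natAdd s j) • X j, ∑ i, c (Fin.castAdd n i) • f i, ?_, ?_, ?_, ?_⟩
    · refine (mem_restrictTotalDegree _ _ _).1 (Submodule.sum_mem _ fun j _ =>
        Submodule.smul_mem _ _ ((mem_restrictTotalDegree _ _ _).2 ?_))
      rw [totalDegree_X]
    · exact Submodule.sum_mem _ fun i _ => Submodule.smul_mem _ _ (Submodule.subset_span ⟨i, rfl⟩)
    · exact (mem_restrictTotalDegree _ _ _).1 (Submodule.sum_mem _ fun i _ =>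
        Submodule.smul_mem _ _ ((mem_restrictTotalDegree _ _ _).2 (hd i)))
    · rw [← hc, Fin.sum_univ_add, map_add, map_sum, map_sum]
      have h1 : ∀ i, finSuccEquiv k n (c (Fin.castAdd n i) • y (Fin.castAdd n i)) =
          Polynomial.X * Polynomial.C (c (Fin.castAdd n i) • f i) := fun i => by
        rw [hy, Fin.append_left]; exact hΦu i _
      have h2 : ∀ j, finSuccEquiv k n (c (Fin.natAdd s j) • y (Fin.natAdd s j)) =
          Polynomial.C (c (Fin.natAdd s j) • X j) := fun j => by
        rw [hy, Fin.append_right]; exact hΦv j _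
      simp only [h1, h2]
      rw [← Finset.mul_sum, ← map_sum, ← map_sum, add_comm]
  choose lam ψ hlam hψ hψd hΦL using hdecomp
  have hΦL' : (fun t => finSuccEquiv k n (L t)) = linSubst lam ψ := funext fun t => hΦL t
  -- apply `Φ` to the identity
  have hident' : ∑ j ∈ Finset.range (M + 1),
      aeval (linSubst lam ψ) (μ₀.coeff j) * Polynomial.X ^ j =
        (0 : Polynomial (MvPolynomial (Fin n) k)) := by
    have h := congrArg (finSuccEquiv k n) hident
    rw [map_sum, map_zero] at h
    rw [← h]
    refine Finset.sum_congr rfl fun j _ => ?_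
    rw [map_mul, map_pow]
    congr 1
    · rw [← hΦL']
      change _ = ((finSuccEquiv k n).toAlgHom.comp (aeval L)) (μ₀.coeff j)
      rw [MvPolynomial.comp_aeval]
      rfl
    · rw [hz0, finSuccEquiv_X_zero]
  -- the coefficient of `Z^M`
  have hgood : ∀ j, GoodCoeffs f d (aeval (linSubst lam ψ) (μ₀.coeff j)) B := fun j =>
    goodCoeffs_aeval_linSubst hlam hψ hψd (hcoeff_deg j)
  have hcoefM := congrArg (fun T : Polynomial (MvPolynomial (Fin n) k) => T.coeff M) hident'
  simp only [Polynomial.finsetSum_coeff, Polynomial.coeff_mul_X_pow', Polynomial.coeff_zero]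
    at hcoefM
  rw [Finset.sum_range_succ, if_pos le_rfl, Nat.sub_self] at hcoefM
  have hlead : (aeval (linSubst lam ψ) (μ₀.coeff M)).coeff 0 = 1 := by
    have : μ₀.coeff M = 1 := hμ₀m.coeff_natDegree
    rw [this, map_one, Polynomial.coeff_one_zero]
  rw [hlead] at hcoefM
  -- the remaining terms lie in `(f)_{≤ B(d+1)}`
  have hrest : ∑ j ∈ Finset.range M, (if j ≤ M then
      (aeval (linSubst lam ψ) (μ₀.coeff j)).coeff (M - j) else 0) ∈ idealUpTo f (B * (d + 1)) := by
    refine Submodule.sum_mem _ fun j hj => ?_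
    rw [Finset.mem_range] at hj
    rw [if_pos hj.le]
    exact (hgood j).1 (M - j) (by omega)
  have hone : (1 : MvPolynomial (Fin n) k) ∈ idealUpTo f (B * (d + 1)) := by
    have h1 : (1 : MvPolynomial (Fin n) k) = -(∑ j ∈ Finset.range M, (if j ≤ M then
        (aeval (linSubst lam ψ) (μ₀.coeff j)).coeff (M - j) else 0)) := by
      linear_combination hcoefM
    rw [h1]
    exact Submodule.neg_mem _ hrest
  obtain ⟨g, hg, hg1⟩ := mem_idealUpTo_iff.1 hone
  exact ⟨g, hg1, fun i => (hg i).trans (by rw [effNSBound, hB])⟩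

end Main

end Literature.RingTheory.Nullstellensatz

end
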